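import Summits.AtomisticToContinuum.FouriersLaw.Theorems.BondHeatUncertaintyExtensiveSnapshotIrreversibilityEnergyWindow

/-!
# Crux `ExtensiveSnapshotIrreversibility` (stmt-AtomisticToContinuum-9121), fixed-`N` half `K_fix`:
the energy-window seam with an `Lᵖ`-MOMENT tail (node «OddLogRatioMomentLadder», part 1a/3)

(helper file, theorem-side; decomp-a2c lens-1 «grading / quantitative ladder», generation 88.)

The landed seam `klDiv_flip_tilted_le_window` (`…EnergyWindow`) splits
`KL(μ ‖ Θ_*μ) = ∫ e^{φ} (φ − φ∘Θ) dμ₀` (`μ = μ₀ · e^{φ}`, `μ₀` flip-invariant) at the Lyapunov window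
`{e^{κW} ≤ 1/u²}`: the BULK is controlled by the odd quadratic form and the window floor, the TAIL by
the exponential moment `∫ e^{θW} dμ ≤ C₁` TIMES the crude POINTWISE odd bound
`|φ − φ∘Θ| ≤ C₂(1 + W)^k` — clause (T2o), atom A2 `NessOddLogRatioBound` of the chain, the one
atom of `K_fix` still tagged IDEA-NEEDED.  This file re-proves the seam with (T2o) replaced by an
INTEGRATED hypothesis, the `Lᵖ(μ)`-moment of the odd log-density for ONE Hölder exponent `p > 1`:

* `klDiv_flip_tilted_le_window_moment` — explicit constants: with `∫ |φ − φ∘Θ|ᵖ e^{φ} dμ₀ ≤ A`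
  (`1/p + 1/q = 1`), an ALMOST-EVERYWHERE window floor `e^{φ} ≥ 1 − C₃u²(1 + W)^m e^{aW}`
  (`2a < κ`), a free window LEVEL `n` (`nκ ≤ θ`) and a free Young weight `λ > 0`:
  `KL(μ ‖ Θ_*μ) ≤ ½(1 + 2η)D + (λᵖ/p) A + (λ^{-q}/q) C₁ u^{2n}`.  Tail: on the complement
  `1 ≤ u^{2n} e^{θW}` and Young `|d| ≤ (λᵖ/p)|d|ᵖ + λ^{-q}/q`; no pointwise bound on `d` is used.
* the filter form `klDiv_flip_le_of_energyWindow_moment` along a family `μ_δ = μ₀ · e^{φ_δ}` is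
  part 1b (`…EnergyWindowOddMomentB`): (T1) + (T2ₚ) `∫ |φ_δ − φ_δ∘Θ|ᵖ dμ_δ ≤ C₂ |δ|^{−r}` (ANY
  polynomial blow-up `r`) + (B1w) for every slack `a > 0` (a.e.) + (B2) give `KL ≤ K δ²` eventually
  for every `K > D/2` (`λ = |δ|^{(r⁺+3)/p}`, level `n ≥ 3 + (r⁺ + 3)q/p`: both tail terms `O(|δ|³)`).

Why this is the quantitative ladder of A2 (parts 2–3, `…EnergyWindowOddMomentChain`, `…Ladder`): the
glue needs the odd log-density `ψ_δ = φ_δ − φ_δ∘Θ` in `Lᵖ(μ_δ)` for SOME `p > 1` with polynomial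
blow-up in `δ`; `p = ∞` (polynomial in `H`) is A2; `p = 1` (signed, bound `Kδ²`) IS `K_fix`, and
`p = 1` unsigned is below the target (free from any polynomial KL bound).  No new objects.
[folklore throughout: Young/Hölder + Chebyshev on the Lyapunov weight]
References: as in `…EnergyWindowTree` (Rey-Bellet–Thomas 2002; Carmona 2007; Eckmann–Pillet–Rey-Bellet
1999; Hairer–Majda 2010; Lelièvre–Stoltz 2016 §5).
-/

noncomputable section

namespace Summit.AtomisticToContinuum.FouriersLaw.Theorems.ExtensiveSnapshotIrreversibility.EnergyWindow

open MeasureTheory Filter Topology InformationTheory Real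
open scoped ENNReal NNReal
open Literature.MathematicalPhysics.KineticTheory.HeatConduction
open Summit.AtomisticToContinuum.FouriersLaw.Theorems.ExtensiveSnapshotIrreversibility.Negative
open Summit.AtomisticToContinuum.FouriersLaw.Theorems.ExtensiveSnapshotIrreversibility.ClausiusBudget.OddLogDensity

variable {N : ℕ}

/-! ## 1. Two pointwise inequalities: Young's inequality with a weight, the window complement -/

/-- Young's inequality in the form used on the tail: `|x| ≤ (λᵖ/p)|x|ᵖ + (1/λ)^q/q` for Hölder
conjugate `p, q` and `λ > 0`. [folklore] -/
theorem abs_le_young {x lam p q : ℝ} (hpq : p.HolderConjugate q) (hlam : 0 < lam) :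
    |x| ≤ lam ^ p / p * |x| ^ p + (1 / lam) ^ q / q := by
  have h := Real.young_inequality_of_nonneg (a := lam * |x|) (b := 1 / lam)
    (by positivity) (by positivity) hpq
  have e1 : lam * |x| * (1 / lam) = |x| := by field_simp
  rw [e1, Real.mul_rpow hlam.le (abs_nonneg x)] at h
  calc |x| ≤ lam ^ p * |x| ^ p / p + (1 / lam) ^ q / q := h
    _ = lam ^ p / p * |x| ^ p + (1 / lam) ^ q / q := by ring

/-- On the complement of the window `{e^{κw} ≤ 1/u²}` the Lyapunov weight is large:
if `1/u² < e^{κ w}` (`u > 0`, `w ≥ 0`) and `nκ ≤ θ` then `1 ≤ u^{2n} e^{θ w}`. [folklore] -/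
theorem one_le_pow_mul_exp_of_window {κ θ w u : ℝ} {n : ℕ} (hu : 0 < u) (hw : 0 ≤ w)
    (hn : (n : ℝ) * κ ≤ θ) (h : 1 / u ^ 2 < exp (κ * w)) :
    1 ≤ u ^ (2 * n) * exp (θ * w) := by
  have hu2 : 0 < u ^ 2 := by positivity
  have h1 : 1 ≤ u ^ 2 * exp (κ * w) := by
    have := (div_lt_iff₀ hu2).1 h
    linarith
  have h2 : 1 ≤ (u ^ 2 * exp (κ * w)) ^ n := one_le_pow₀ h1
  have h3 : (u ^ 2 * exp (κ * w)) ^ n = u ^ (2 * n) * exp ((n : ℝ) * κ * w) := by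
    rw [mul_pow, ← pow_mul, ← exp_nat_mul]
    ring_nf
  have h4 : exp ((n : ℝ) * κ * w) ≤ exp (θ * w) :=
    exp_le_exp.2 (mul_le_mul_of_nonneg_right hn hw)
  calc 1 ≤ (u ^ 2 * exp (κ * w)) ^ n := h2
    _ = u ^ (2 * n) * exp ((n : ℝ) * κ * w) := h3
    _ ≤ u ^ (2 * n) * exp (θ * w) := mul_le_mul_of_nonneg_left h4 (by positivity)

/-! ## 2. One tilted state: the energy-window bound with a moment tail, explicit constants -/

section Seam

variable (μ₀ : Measure (PhaseSpace N)) [IsProbabilityMeasure μ₀]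

/-- **Energy-window bound for one tilted state, `Lᵖ`-moment tail (explicit constants).** `μ₀` a
flip-invariant probability measure, `W ≥ 0` a flip-invariant measurable weight, `μ = μ₀ · e^{φ}`
(`∫ e^φ dμ₀ = 1`), `d := φ − φ∘Θ`.  Assume, with `u > 0` (think `u = √|δ|`), Hölder conjugate
`p, q`, a window rate `κ > 2a`, a level `n` with `nκ ≤ θ` and a Young weight `λ > 0`: the exponential
moment `∫ e^{θW} e^{φ} dμ₀ ≤ C₁`, the MOMENT `∫ |d|ᵖ e^{φ} dμ₀ ≤ A` (in place of the pointwise odd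
bound of `klDiv_flip_tilted_le_window`), the window floor `e^{φ} ≥ 1 − C₃u²(1 + W)^m e^{aW}`
ALMOST EVERYWHERE (`C₃ ≥ 0`, `m! e^{s}/s^m ≤ M'`, `s = κ/2 − a`), `∫ (e^φ − e^{φ∘Θ})² dμ₀ ≤ D` and the
smallness `η := C₃ M' u ≤ 1/2`.  Then
`KL(μ ‖ Θ_*μ) ≤ ½(1 + 2η) D + (λᵖ/p) A + ((1/λ)^q/q) C₁ u^{2n}`
(window `{e^{κW} ≤ 1/u²}`; bulk as in the seam; tail by Young and `1 ≤ u^{2n} e^{θW}` off the window).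
[folklore] -/
theorem klDiv_flip_tilted_le_window_moment
    (hinv : μ₀.map (fun x : PhaseSpace N => (x.1, -x.2)) = μ₀)
    {W : PhaseSpace N → ℝ} (hWm : Measurable W) (hW0 : ∀ x, 0 ≤ W x)
    (hWflip : ∀ x : PhaseSpace N, W (x.1, -x.2) = W x)
    {φ : PhaseSpace N → ℝ} (hφm : Measurable φ)
    (hZ : Integrable (fun x => exp (φ x)) μ₀) (hZ1 : ∫ x, exp (φ x) ∂μ₀ = 1)
    {θ κ a C₁ C₃ M' A lam u D p q : ℝ} {m n : ℕ} (hpq : p.HolderConjugate q)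
    (ha : 2 * a < κ) (hn : (n : ℝ) * κ ≤ θ) (hu : 0 < u) (hlam : 0 < lam)
    (hC₃ : 0 ≤ C₃) (hM' : (m.factorial : ℝ) * exp (κ / 2 - a) / (κ / 2 - a) ^ m ≤ M')
    (hT1i : Integrable (fun x => exp (θ * W x) * exp (φ x)) μ₀)
    (hT1 : ∫ x, exp (θ * W x) * exp (φ x) ∂μ₀ ≤ C₁)
    (hT2i : Integrable (fun x => |φ x - φ (x.1, -x.2)| ^ p * exp (φ x)) μ₀)
    (hT2 : ∫ x, |φ x - φ (x.1, -x.2)| ^ p * exp (φ x) ∂μ₀ ≤ A)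
    (hB1 : ∀ᵐ x ∂μ₀, 1 - C₃ * u ^ 2 * (1 + W x) ^ m * exp (a * W x) ≤ exp (φ x))
    (hB2i : Integrable (fun x => (exp (φ x) - exp (φ (x.1, -x.2))) ^ 2) μ₀)
    (hB2 : ∫ x, (exp (φ x) - exp (φ (x.1, -x.2))) ^ 2 ∂μ₀ ≤ D)
    (hη : C₃ * M' * u ≤ 1 / 2) :
    klDiv (μ₀.tilted φ) ((μ₀.tilted φ).map (fun x : PhaseSpace N => (x.1, -x.2))) ≤
      ENNReal.ofReal ((1 / 2) * (1 + 2 * (C₃ * M' * u)) * D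
          + lam ^ p / p * A + (1 / lam) ^ q / q * C₁ * u ^ (2 * n)) := by
  -- constants
  set s : ℝ := κ / 2 - a with hs
  have hspos : 0 < s := by rw [hs]; linarith
  have hM₀pos : 0 < (m.factorial : ℝ) * exp s / s ^ m := by positivity
  have hM'pos : 0 < M' := hM₀pos.trans_le hM'
  set η : ℝ := C₃ * M' * u with hηdef
  have hη0 : 0 ≤ η := by rw [hηdef]; positivity
  have hη2 : η ≤ 1 / 2 := hη
  have hp : 0 < p := hpq.pos
  have hq : 0 < q := hpq.symm.pos
  have hD : 0 ≤ D := (integral_nonneg fun x => sq_nonneg _).trans hB2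
  -- the odd log-density and the density
  set d : PhaseSpace N → ℝ := fun x => φ x - φ (x.1, -x.2) with hd
  have hΘm : Measurable (fun x : PhaseSpace N => (x.1, -x.2)) := (momentumReversal N).measurable
  have hdm : Measurable d := hφm.sub (hφm.comp hΘm)
  have hdodd : ∀ x : PhaseSpace N, d (x.1, -x.2) = -d x := fun x => by simp [hd]
  have hem : Measurable fun x => exp (φ x) := hφm.exp
  have hqmp : Measure.QuasiMeasurePreserving (fun x : PhaseSpace N => (x.1, -x.2)) μ₀ μ₀ := by
    refine ⟨hΘm, ?_⟩
    rw [hinv]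
  -- the window
  set S : Set (PhaseSpace N) := {x | exp (κ * W x) ≤ 1 / u ^ 2} with hSdef
  have hS : MeasurableSet S := measurableSet_le (hWm.const_mul κ).exp measurable_const
  have hSflip : ∀ x : PhaseSpace N, (x.1, -x.2) ∈ S ↔ x ∈ S := fun x => by
    simp only [hSdef, Set.mem_setOf_eq, hWflip]
  -- integrability of `e^{φ} d` (Young with weight 1) and of `e^{φ∘Θ} d` (flip)
  have I_d : Integrable (fun x => exp (φ x) * d x) μ₀ := by
    refine ((hT2i.const_mul (1 / p)).add (hZ.const_mul (1 / q))).mono'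
      (hem.mul hdm).aestronglyMeasurable (ae_of_all _ fun x => ?_)
    rw [Real.norm_eq_abs, abs_mul, abs_of_pos (exp_pos _)]
    have h := abs_le_young (x := d x) hpq one_pos
    simp only [one_div_one, Real.one_rpow] at h
    show exp (φ x) * |d x| ≤ 1 / p * (|d x| ^ p * exp (φ x)) + 1 / q * exp (φ x)
    have he := exp_pos (φ x)
    calc exp (φ x) * |d x| ≤ exp (φ x) * (1 / p * |d x| ^ p + 1 / q) :=
          mul_le_mul_of_nonneg_left h he.le
      _ = 1 / p * (|d x| ^ p * exp (φ x)) + 1 / q * exp (φ x) := by ring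
  have I_dΘ : Integrable (fun x : PhaseSpace N => exp (φ (x.1, -x.2)) * d x) μ₀ := by
    have h := (integrable_comp_flip_iff μ₀ hinv (fun x => exp (φ x) * d x)).2 I_d
    refine h.neg.congr (ae_of_all _ fun x => ?_)
    show -(exp (φ (x.1, -x.2)) * d (x.1, -x.2)) = exp (φ (x.1, -x.2)) * d x
    rw [hdodd x]
    ring
  -- the value of the divergence as a `μ₀`-integral, and its finiteness
  have hdt : Integrable d (μ₀.tilted φ) := by
    rw [integrable_tilted_iff hZ d]
    refine I_d.congr (ae_of_all _ fun x => ?_)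
    simp only [smul_eq_mul]
  have hfin : klDiv (μ₀.tilted φ) ((μ₀.tilted φ).map (fun x : PhaseSpace N => (x.1, -x.2))) ≠ ∞ :=
    (klDiv_flip_tilted_ne_top_iff hinv hφm hZ).2 hdt
  have hval : (klDiv (μ₀.tilted φ) ((μ₀.tilted φ).map (fun x : PhaseSpace N => (x.1, -x.2)))).toReal
      = ∫ x, exp (φ x) * d x ∂μ₀ := by
    rw [toReal_klDiv_flip_tilted hinv hφm hZ, integral_tilted]
    refine integral_congr_ae (ae_of_all _ fun x => ?_)
    simp only [hZ1, div_one, smul_eq_mul, hd]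
  -- split at the window
  have hsplit : ∫ x, exp (φ x) * d x ∂μ₀ =
      ∫ x in S, exp (φ x) * d x ∂μ₀ + ∫ x in Sᶜ, exp (φ x) * d x ∂μ₀ :=
    (integral_add_compl hS I_d).symm
  -- BULK: symmetrisation on the (flip-invariant) window
  have hinvS : (μ₀.restrict S).map (fun x : PhaseSpace N => (x.1, -x.2)) = μ₀.restrict S := by
    have hpre : (fun x : PhaseSpace N => (x.1, -x.2)) ⁻¹' S = S := by
      ext x; simp only [Set.mem_preimage]; exact hSflip x
    have hme : MeasurableEmbedding (fun x : PhaseSpace N => (x.1, -x.2)) :=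
      (momentumReversal N).measurableEmbedding
    calc (μ₀.restrict S).map (fun x : PhaseSpace N => (x.1, -x.2))
        = (μ₀.restrict ((fun x : PhaseSpace N => (x.1, -x.2)) ⁻¹' S)).map
            (fun x : PhaseSpace N => (x.1, -x.2)) := by rw [hpre]
      _ = (μ₀.map (fun x : PhaseSpace N => (x.1, -x.2))).restrict S := (hme.restrict_map μ₀ S).symm
      _ = μ₀.restrict S := by rw [hinv]
  have e1 : ∫ x in S, exp (φ (x.1, -x.2)) * d x ∂μ₀ = -∫ x in S, exp (φ x) * d x ∂μ₀ := by
    have h : ∫ x in S, exp (φ (x.1, -x.2)) * d (x.1, -x.2) ∂μ₀ = ∫ x in S, exp (φ x) * d x ∂μ₀ :=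
      integral_comp_flip (μ₀.restrict S) hinvS (fun x => exp (φ x) * d x)
    calc ∫ x in S, exp (φ (x.1, -x.2)) * d x ∂μ₀
        = ∫ x in S, -(exp (φ (x.1, -x.2)) * d (x.1, -x.2)) ∂μ₀ := by
          refine integral_congr_ae (ae_of_all _ fun x => ?_)
          show exp (φ (x.1, -x.2)) * d x = -(exp (φ (x.1, -x.2)) * d (x.1, -x.2))
          rw [hdodd x]
          ring
      _ = -∫ x in S, exp (φ (x.1, -x.2)) * d (x.1, -x.2) ∂μ₀ := integral_neg _
      _ = -∫ x in S, exp (φ x) * d x ∂μ₀ := by rw [h]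
  have I_bulk : Integrable (fun x : PhaseSpace N => d x * (exp (φ x) - exp (φ (x.1, -x.2)))) μ₀ := by
    refine (I_d.sub I_dΘ).congr (ae_of_all _ fun x => ?_)
    simp only [Pi.sub_apply]
    ring
  have e2 : ∫ x in S, exp (φ x) * d x ∂μ₀ =
      (1 / 2) * ∫ x in S, d x * (exp (φ x) - exp (φ (x.1, -x.2))) ∂μ₀ := by
    have h : ∫ x in S, d x * (exp (φ x) - exp (φ (x.1, -x.2))) ∂μ₀ =
        ∫ x in S, exp (φ x) * d x ∂μ₀ - ∫ x in S, exp (φ (x.1, -x.2)) * d x ∂μ₀ := by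
      rw [← integral_sub I_d.integrableOn I_dΘ.integrableOn]
      refine integral_congr_ae (ae_of_all _ fun x => ?_)
      ring
    rw [h, e1]
    ring
  -- on the window both densities are `≥ 1 − η`, ALMOST EVERYWHERE (the floor is an a.e. hypothesis)
  have hfloor : ∀ x ∈ S, 1 - C₃ * u ^ 2 * (1 + W x) ^ m * exp (a * W x) ≤ exp (φ x) →
      1 - η ≤ exp (φ x) := by
    intro x hx hBx
    have hx' : exp (κ * W x) ≤ 1 / u ^ 2 := hx
    have hhalf : exp (κ / 2 * W x) ≤ 1 / u := exp_half_mul_le_of_window hu hx'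
    have hpol : (1 + W x) ^ m ≤ M' * exp (s * W x) :=
      (one_add_pow_le_factorial_mul_exp m (hW0 x) hspos).trans
        (mul_le_mul_of_nonneg_right hM' (exp_pos _).le)
    have hprod : (1 + W x) ^ m * exp (a * W x) ≤ M' * (1 / u) := by
      calc (1 + W x) ^ m * exp (a * W x) ≤ M' * exp (s * W x) * exp (a * W x) :=
            mul_le_mul_of_nonneg_right hpol (exp_pos _).le
        _ = M' * exp (κ / 2 * W x) := by
            rw [mul_assoc, ← exp_add]
            congr 2
            rw [hs]
            ring
        _ ≤ M' * (1 / u) := mul_le_mul_of_nonneg_left hhalf hM'pos.le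
    have hkey : C₃ * u ^ 2 * (1 + W x) ^ m * exp (a * W x) ≤ η := by
      calc C₃ * u ^ 2 * (1 + W x) ^ m * exp (a * W x)
          = C₃ * u ^ 2 * ((1 + W x) ^ m * exp (a * W x)) := by ring
        _ ≤ C₃ * u ^ 2 * (M' * (1 / u)) := mul_le_mul_of_nonneg_left hprod (by positivity)
        _ = η := by rw [hηdef]; field_simp
    linarith
  have hlow : ∀ᵐ x ∂μ₀, x ∈ S → 1 - η ≤ exp (φ x) := by
    filter_upwards [hB1] with x hx hxS
    exact hfloor x hxS hx
  have hlowΘ : ∀ᵐ x ∂μ₀, x ∈ S → 1 - η ≤ exp (φ (x.1, -x.2)) := by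
    filter_upwards [hqmp.ae hlow] with x hx hxS
    exact hx ((hSflip x).2 hxS)
  have e3 : ∀ᵐ x ∂μ₀, x ∈ S → d x * (exp (φ x) - exp (φ (x.1, -x.2))) ≤
      (exp (φ x) - exp (φ (x.1, -x.2))) ^ 2 / (1 - η) := by
    filter_upwards [hlow, hlowΘ] with x h1 h2 hxS
    exact sub_mul_exp_sub_exp_le_sq_div (by linarith) (h1 hxS) (h2 hxS)
  have e4 : ∫ x in S, d x * (exp (φ x) - exp (φ (x.1, -x.2))) ∂μ₀ ≤
      ∫ x in S, (exp (φ x) - exp (φ (x.1, -x.2))) ^ 2 / (1 - η) ∂μ₀ :=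
    setIntegral_mono_on_ae I_bulk.integrableOn (hB2i.div_const _).integrableOn hS e3
  have e5 : ∫ x in S, (exp (φ x) - exp (φ (x.1, -x.2))) ^ 2 / (1 - η) ∂μ₀ ≤ D / (1 - η) := by
    rw [integral_div]
    exact div_le_div_of_nonneg_right
      ((setIntegral_le_integral hB2i (ae_of_all _ fun x => sq_nonneg _)).trans hB2) (by linarith)
  have hbulk : ∫ x in S, exp (φ x) * d x ∂μ₀ ≤ (1 / 2) * (1 + 2 * η) * D := by
    rw [e2]
    have h1 : D / (1 - η) ≤ (1 + 2 * η) * D := by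
      rw [div_eq_mul_one_div, mul_comm]
      exact mul_le_mul_of_nonneg_right (one_div_one_sub_le hη0 hη2) hD
    nlinarith [e4, e5, h1]
  -- TAIL: Young `e^φ d ≤ (λᵖ/p)|d|ᵖe^φ + (λ^{-q}/q) e^φ` and `e^φ ≤ u^{2n} e^{θW} e^φ` off the window
  have htailpt : ∀ x ∈ Sᶜ, exp (φ x) * d x ≤ lam ^ p / p * (|d x| ^ p * exp (φ x)) +
      (1 / lam) ^ q / q * u ^ (2 * n) * (exp (θ * W x) * exp (φ x)) := by
    intro x hx
    have hx' : 1 / u ^ 2 < exp (κ * W x) := lt_of_not_ge hx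
    have hwin : 1 ≤ u ^ (2 * n) * exp (θ * W x) := one_le_pow_mul_exp_of_window hu (hW0 x) hn hx'
    have he := exp_pos (φ x)
    have hy : |d x| ≤ lam ^ p / p * |d x| ^ p + (1 / lam) ^ q / q := abs_le_young hpq hlam
    have hc : 0 ≤ (1 / lam) ^ q / q := by positivity
    have hwin' : 1 * exp (φ x) ≤ u ^ (2 * n) * exp (θ * W x) * exp (φ x) :=
      mul_le_mul_of_nonneg_right hwin he.le
    calc exp (φ x) * d x ≤ exp (φ x) * |d x| := mul_le_mul_of_nonneg_left (le_abs_self _) he.le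
      _ ≤ exp (φ x) * (lam ^ p / p * |d x| ^ p + (1 / lam) ^ q / q) :=
          mul_le_mul_of_nonneg_left hy he.le
      _ = lam ^ p / p * (|d x| ^ p * exp (φ x)) + (1 / lam) ^ q / q * (1 * exp (φ x)) := by ring
      _ ≤ lam ^ p / p * (|d x| ^ p * exp (φ x)) +
            (1 / lam) ^ q / q * (u ^ (2 * n) * exp (θ * W x) * exp (φ x)) :=
          by linarith [mul_le_mul_of_nonneg_left hwin' hc]
      _ = lam ^ p / p * (|d x| ^ p * exp (φ x)) +
            (1 / lam) ^ q / q * u ^ (2 * n) * (exp (θ * W x) * exp (φ x)) := by ring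
  have I_tailR : Integrable (fun x => lam ^ p / p * (|d x| ^ p * exp (φ x)) +
      (1 / lam) ^ q / q * u ^ (2 * n) * (exp (θ * W x) * exp (φ x))) μ₀ :=
    (hT2i.const_mul (lam ^ p / p)).add (hT1i.const_mul ((1 / lam) ^ q / q * u ^ (2 * n)))
  have htail : ∫ x in Sᶜ, exp (φ x) * d x ∂μ₀ ≤
      lam ^ p / p * A + (1 / lam) ^ q / q * C₁ * u ^ (2 * n) := by
    have t1 : ∫ x in Sᶜ, exp (φ x) * d x ∂μ₀ ≤ ∫ x in Sᶜ, (lam ^ p / p * (|d x| ^ p * exp (φ x)) +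
        (1 / lam) ^ q / q * u ^ (2 * n) * (exp (θ * W x) * exp (φ x))) ∂μ₀ :=
      setIntegral_mono_on I_d.integrableOn I_tailR.integrableOn hS.compl htailpt
    have t2 := integral_add (μ := μ₀.restrict Sᶜ) (hT2i.const_mul (lam ^ p / p)).integrableOn
      (hT1i.const_mul ((1 / lam) ^ q / q * u ^ (2 * n))).integrableOn
    rw [integral_const_mul, integral_const_mul] at t2
    have t3 : ∫ x in Sᶜ, |d x| ^ p * exp (φ x) ∂μ₀ ≤ A :=
      (setIntegral_le_integral hT2i (ae_of_all _ fun x =>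
        mul_nonneg (Real.rpow_nonneg (abs_nonneg _) _) (exp_pos _).le)).trans hT2
    have t4 : ∫ x in Sᶜ, exp (θ * W x) * exp (φ x) ∂μ₀ ≤ C₁ :=
      (setIntegral_le_integral hT1i (ae_of_all _ fun x => by positivity)).trans hT1
    have hc1 : 0 ≤ lam ^ p / p := by positivity
    have hc2 : 0 ≤ (1 / lam) ^ q / q * u ^ (2 * n) := by positivity
    calc ∫ x in Sᶜ, exp (φ x) * d x ∂μ₀
        ≤ lam ^ p / p * ∫ x in Sᶜ, |d x| ^ p * exp (φ x) ∂μ₀ +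
          (1 / lam) ^ q / q * u ^ (2 * n) * ∫ x in Sᶜ, exp (θ * W x) * exp (φ x) ∂μ₀ :=
          t1.trans (le_of_eq t2)
      _ ≤ lam ^ p / p * A + (1 / lam) ^ q / q * u ^ (2 * n) * C₁ :=
          add_le_add (mul_le_mul_of_nonneg_left t3 hc1) (mul_le_mul_of_nonneg_left t4 hc2)
      _ = lam ^ p / p * A + (1 / lam) ^ q / q * C₁ * u ^ (2 * n) := by ring
  -- conclusion
  rw [← ENNReal.ofReal_toReal hfin, hval, hsplit]
  exact ENNReal.ofReal_le_ofReal (by linarith [hbulk, htail])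

end Seam

end Summit.AtomisticToContinuum.FouriersLaw.Theorems.ExtensiveSnapshotIrreversibility.EnergyWindow

end
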